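import Literature.NumberTheory.Automorphic.BrandtMatrixClassFunction
import Literature.NumberTheory.Automorphic.BrandtWeightClassFunction
import Literature.NumberTheory.Automorphic.BrandtWeightPos
import HarnessLib

/-!
# Brandt matrix entries as counts of elements: `2 w_i · T(n)_ij = #{α ∈ Dˣ : α I_i ⊆ I_j, [I_j : α I_i] = n²}`

Topic `NumberTheory/Automorphic`; theorems only (no definition, no named fact, no instance).
A brick of the Brandt-module side of Pollack–Weston 2011, Thm. 6.8 (identification (iv) of the
module docstring of `PollackWestonCongruence.lean`: `Pic(X_{N⁺,N⁻}) = ℤ[Cls O]` with Gross's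
Hecke correspondences and height pairing `⟨e_i, e_j⟩ = w_i δ_ij`).

The tree's Brandt matrix (`Brandt.matrix` of `BrandtXi.lean`; Voight (41.1.1), Pizer 1980 §2,
Vignéras III Ex. 5.8) counts *lattices*:
`T(n)_ij = #{J ⊆ I_j : [I_j : J] = n², J = α I_i for some α ∈ Dˣ}`.
The classical sources equally often count *elements*: Gross 1987 §1 / Pizer 1980 Prop. 2.3-type
formulas `B_ij(n) = e_j⁻¹ #{α ∈ I_j⁻¹ I_i : nrd α = n · nrd I_i / nrd I_j}`, `e_j = |O_jˣ|`, and the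
diagonal entries "le terme `α_{i,i}` … est égal au nombre des idéaux principaux de `O^(i)` de norme
réduite `A`" (Vignéras V §2, before Prop. 2.4) are numbers of elements modulo units. The passage
between the two is the orbit–stabiliser count proved here, for an arbitrary ring `D`, lattices
`I', I ⊆ D` and `n`:

* `Brandt.mem_stabilizer_iff_mem_leftOrder`, `Brandt.nonempty_stabilizerEquivUnits` — the stabiliser
  of a lattice `I` under left translation by `Dˣ` is the group of two-sided units of its left
  order `O_L(I)` (the set counted by `Brandt.unitIndex`); `-1` lies in it, so (`1 ≠ -1`) its order
  is even and equals `2 · unitIndex (O_L I)` (`Brandt.card_stabilizer_eq_two_mul_unitIndex`);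
* `Brandt.nonempty_equiv_brandtSet_prod_stabilizer` — **orbit–stabiliser**: `α ↦ α I'` is a
  bijection `{α ∈ Dˣ : α I' ⊆ I, [I : α I'] = n²} ≃ {J ⊆ I : [I : J] = n², J ∈ Dˣ I'} × Stab(I')`
  (the fibre over `J = α I'` is the coset `α · Stab(I')`), whence
  `Brandt.card_eq_ncard_brandtSet_mul_card_stabilizer`;
* `Brandt.two_mul_weight_mul_matrix_apply` — **`2 w_i T(n)_ij = #{α ∈ Dˣ : α I_i ⊆ I_j,
  [I_j : α I_i] = n²}`** for the classes `i = [I_i]`, `j = [I_j]` of any ring `D` with `1 ≠ -1`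
  (on the chosen representatives; `Brandt.two_mul_unitIndex_mul_ncard_brandtSet` for arbitrary
  lattices), and `Brandt.XiSetup.two_mul_weight_mul_matrix_apply` for Brandt setups, where
  `1 ≠ -1` is automatic. Both sides are honest cardinalities for setups (finite unit groups,
  `DefiniteOrderUnitsFinite.lean`; finite Brandt sets, `finite_brandtSet`); in general the
  identity holds with `Nat.card = 0` on infinite sets on both sides.
* `Brandt.matrix_zero` — the junk row `n = 0`: `T(0) = 0` (a translate `α I_i` of a full lattice
  has finite index in `I_j`, never "index `0`").

## References

* J. Voight, *Quaternion Algebras*, GTM 288 (2021), (41.1.1), 41.1.3 [Voight2021].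
* A. Pizer, *An algorithm for computing modular forms on `Γ₀(N)`*, J. Algebra 64 (1980), §2
  [Pizer1980].
* B. H. Gross, *Heights and the special values of L-series*, CMS Conf. Proc. 7 (1987), §1
  [Gross1987].
* M.-F. Vignéras, *Arithmétique des algèbres de quaternions*, LNM 800 (1980), Ch. III Ex. 5.8,
  Ch. V §2 [VignerasLNM800].
-/

noncomputable section

open scoped Pointwise

universe u

namespace Literature.NumberTheory.Automorphic

namespace Brandt

variable {D : Type u} [Ring D]

/-! ### The stabiliser of a lattice is the unit group of its left order -/

/-- `u ∈ Dˣ` fixes the lattice `I` (`u I = I`) iff `u` and `u⁻¹` lie in the left order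
`O_L(I)`. [folklore] -/
theorem mem_stabilizer_iff_mem_leftOrder (I : Submodule ℤ D) (u : Dˣ) :
    u ∈ MulAction.stabilizer Dˣ I ↔ (u : D) ∈ leftOrder I ∧ ((u⁻¹ : Dˣ) : D) ∈ leftOrder I := by
  rw [MulAction.mem_stabilizer_iff]
  constructor
  · intro h
    refine ⟨fun m hm => ?_, fun m hm => ?_⟩
    · have hm' : u • m ∈ u • I := Submodule.smul_mem_pointwise_smul m u I hm
      rwa [h, Units.smul_def, smul_eq_mul] at hm'
    · have hm' : m ∈ u • I := by rw [h]; exact hm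
      rwa [mem_units_smul_submodule_iff, Units.smul_def, smul_eq_mul] at hm'
  · rintro ⟨hu, hu'⟩
    apply le_antisymm
    · intro x hx
      obtain ⟨m, hm, rfl⟩ := (Submodule.mem_smul_pointwise_iff_exists x u I).mp hx
      rw [Units.smul_def, smul_eq_mul]
      exact hu m hm
    · intro m hm
      rw [mem_units_smul_submodule_iff, Units.smul_def, smul_eq_mul]
      exact hu' m hm

/-- `-1` fixes every lattice. [folklore] -/
theorem neg_one_mem_stabilizer (I : Submodule ℤ D) : (-1 : Dˣ) ∈ MulAction.stabilizer Dˣ I := by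
  rw [mem_stabilizer_iff_mem_leftOrder, inv_neg_one, Units.val_neg, Units.val_one]
  exact ⟨(leftOrder I).neg_mem (one_mem_leftOrder I), (leftOrder I).neg_mem (one_mem_leftOrder I)⟩

/-- **The stabiliser of `I` in `Dˣ` is the group of two-sided units of `O_L(I)`**: a bijection
with the set `{x ∈ O_L(I) : ∃ y ∈ O_L(I), x y = y x = 1}` counted by `Brandt.unitIndex` (stated as
`Nonempty (_ ≃ _)` to keep this file free of definitions). [folklore] -/
theorem nonempty_stabilizerEquivUnits (I : Submodule ℤ D) :
    Nonempty (MulAction.stabilizer Dˣ I ≃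
      {x : D // x ∈ leftOrder I ∧ ∃ y ∈ leftOrder I, x * y = 1 ∧ y * x = 1}) := ⟨{
  toFun := fun u => ⟨u.1, ((mem_stabilizer_iff_mem_leftOrder I u.1).mp u.2).1, ((u.1⁻¹ : Dˣ) : D),
    ((mem_stabilizer_iff_mem_leftOrder I u.1).mp u.2).2, u.1.mul_inv, u.1.inv_mul⟩
  invFun := fun x => ⟨⟨x.1, x.2.2.choose, x.2.2.choose_spec.2.1, x.2.2.choose_spec.2.2⟩,
    (mem_stabilizer_iff_mem_leftOrder I _).mpr ⟨x.2.1, x.2.2.choose_spec.1⟩⟩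
  left_inv := fun _ => Subtype.ext (Units.ext rfl)
  right_inv := fun _ => Subtype.ext rfl }⟩

/-- The order of the stabiliser is even when `1 ≠ -1` in `D` (it contains the element `-1` of
order `2`; for an infinite stabiliser `Nat.card = 0`). [folklore] -/
theorem two_dvd_card_stabilizer (hne : (1 : D) ≠ -1) (I : Submodule ℤ D) :
    2 ∣ Nat.card (MulAction.stabilizer Dˣ I) := by
  have h2 : orderOf (⟨-1, neg_one_mem_stabilizer I⟩ : MulAction.stabilizer Dˣ I) = 2 := by
    refine orderOf_eq_prime ?_ ?_
    · exact Subtype.ext (Units.ext (by simp))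
    · intro h
      have h' := congrArg (fun u : MulAction.stabilizer Dˣ I => ((u : Dˣ) : D)) h
      simp only [Units.val_neg, Units.val_one, OneMemClass.coe_one] at h'
      exact hne h'.symm
  rw [← h2]
  exact orderOf_dvd_natCard _

/-- `#Stab(I) = 2 · unitIndex (O_L I)` (`unitIndex = #units / 2` and `#units` is even). [folklore] -/
theorem card_stabilizer_eq_two_mul_unitIndex (hne : (1 : D) ≠ -1) (I : Submodule ℤ D) :
    Nat.card (MulAction.stabilizer Dˣ I) = 2 * unitIndex (leftOrder I) := by
  obtain ⟨e⟩ := nonempty_stabilizerEquivUnits I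
  rw [unitIndex, ← Nat.card_congr e, Nat.mul_div_cancel' (two_dvd_card_stabilizer hne I)]

/-! ### Orbit–stabiliser for the Brandt sets -/

/-- **Orbit–stabiliser for Brandt-matrix entries.** For lattices `I', I` and `n`, the map
`α ↦ α I'` induces a bijection
`{α ∈ Dˣ : α I' ⊆ I, [I : α I'] = n²} ≃ {J ⊆ I : [I : J] = n², J = α I'} × Stab_{Dˣ}(I')`:
choosing `σ_J` with `σ_J I' = J` for each `J` in the Brandt set, `(J, u) ↦ σ_J u` is a bijection
(its inverse is `α ↦ (α I', σ_{α I'}⁻¹ α)`). Stated as `Nonempty (_ ≃ _)`. [folklore] -/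
theorem nonempty_equiv_brandtSet_prod_stabilizer (n : ℕ) (I' I : Submodule ℤ D) :
    Nonempty ({α : Dˣ // α • I' ≤ I ∧ (α • I').toAddSubgroup.relIndex I.toAddSubgroup = n ^ 2} ≃
      ({J : Submodule ℤ D | J ≤ I ∧ J.toAddSubgroup.relIndex I.toAddSubgroup = n ^ 2 ∧
          ∃ α : Dˣ, J = α • I'} × MulAction.stabilizer Dˣ I')) := by
  classical
  set B : Set (Submodule ℤ D) := {J : Submodule ℤ D | J ≤ I ∧
    J.toAddSubgroup.relIndex I.toAddSubgroup = n ^ 2 ∧ ∃ α : Dˣ, J = α • I'} with hB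
  -- a section `σ` of `α ↦ α I'` over the Brandt set
  have hsec : ∀ J : B, ∃ α : Dˣ, (J : Submodule ℤ D) = α • I' := fun J => J.2.2.2
  choose σ hσ using hsec
  have hback : ∀ (J : B) (u : MulAction.stabilizer Dˣ I'),
      (σ J * (u : Dˣ)) • I' = (J : Submodule ℤ D) := fun J u => by
    rw [mul_smul, MulAction.mem_stabilizer_iff.mp u.2, ← hσ J]
  let g : B × MulAction.stabilizer Dˣ I' →
      {α : Dˣ // α • I' ≤ I ∧ (α • I').toAddSubgroup.relIndex I.toAddSubgroup = n ^ 2} :=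
    fun p => ⟨σ p.1 * (p.2 : Dˣ), by rw [hback]; exact ⟨p.1.2.1, p.1.2.2.1⟩⟩
  have hg : Function.Bijective g := by
    constructor
    · rintro ⟨J, u⟩ ⟨J', u'⟩ h
      have h1 : σ J * (u : Dˣ) = σ J' * (u' : Dˣ) := congrArg Subtype.val h
      have hJ : J = J' := by
        apply Subtype.ext
        rw [← hback J u, ← hback J' u', h1]
      subst hJ
      have hu : u = u' := Subtype.ext (mul_left_cancel h1)
      rw [hu]
    · rintro ⟨a, ha⟩
      let J : B := ⟨a • I', ha.1, ha.2, a, rfl⟩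
      have hu : (σ J)⁻¹ * a ∈ MulAction.stabilizer Dˣ I' := by
        rw [MulAction.mem_stabilizer_iff, mul_smul, inv_smul_eq_iff]
        exact hσ J
      exact ⟨(J, ⟨(σ J)⁻¹ * a, hu⟩), Subtype.ext (mul_inv_cancel_left _ _)⟩
  exact ⟨(Equiv.ofBijective g hg).symm⟩

/-- **`#{α ∈ Dˣ : α I' ⊆ I, [I : α I'] = n²} = #{J ⊆ I : [I : J] = n², J ∈ Dˣ I'} · #Stab(I')`**
(`Nat.card`; both sides are `0` when the stabiliser is infinite and the Brandt set non-empty). [folklore] -/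
theorem card_eq_ncard_brandtSet_mul_card_stabilizer (n : ℕ) (I' I : Submodule ℤ D) :
    Nat.card {α : Dˣ // α • I' ≤ I ∧ (α • I').toAddSubgroup.relIndex I.toAddSubgroup = n ^ 2} =
      {J : Submodule ℤ D | J ≤ I ∧ J.toAddSubgroup.relIndex I.toAddSubgroup = n ^ 2 ∧
          ∃ α : Dˣ, J = α • I'}.ncard * Nat.card (MulAction.stabilizer Dˣ I') := by
  obtain ⟨e⟩ := nonempty_equiv_brandtSet_prod_stabilizer n I' I
  rw [Nat.card_congr e, Nat.card_prod, Nat.card_coe_set_eq]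

/-- **`2 · w(O_L I') · #{J ⊆ I : [I : J] = n², J ∈ Dˣ I'} = #{α ∈ Dˣ : α I' ⊆ I, [I : α I'] = n²}`**
for arbitrary lattices `I', I` of a ring with `1 ≠ -1`. [folklore] -/
theorem two_mul_unitIndex_mul_ncard_brandtSet (hne : (1 : D) ≠ -1) (n : ℕ)
    (I' I : Submodule ℤ D) :
    2 * unitIndex (leftOrder I') *
        {J : Submodule ℤ D | J ≤ I ∧ J.toAddSubgroup.relIndex I.toAddSubgroup = n ^ 2 ∧
          ∃ α : Dˣ, J = α • I'}.ncard =
      Nat.card {α : Dˣ // α • I' ≤ I ∧ (α • I').toAddSubgroup.relIndex I.toAddSubgroup = n ^ 2} := by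
  rw [card_eq_ncard_brandtSet_mul_card_stabilizer, card_stabilizer_eq_two_mul_unitIndex hne,
    mul_comm]

/-- **Brandt matrix entries count elements: `2 w_i · T(n)_ij = #{α ∈ Dˣ : α I_i ⊆ I_j,
[I_j : α I_i] = n²}`** (`w_i = |O_L(I_i)ˣ| / 2`, `I_i, I_j` the chosen representatives of the
classes `i, j`), for any ring `D` with `1 ≠ -1` — the orbit–stabiliser passage between Voight's
lattice count (41.1.1) and the element counts of Pizer 1980 §2 / Gross 1987 §1. [cite: Voight2021, (41.1.1) and 41.1.3] -/
theorem two_mul_weight_mul_matrix_apply (hne : (1 : D) ≠ -1) (O : Submodule ℤ D) (n : ℕ)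
    (i j : ClassSet O) :
    (2 * weight O i : ℤ) * matrix O n i j =
      Nat.card {α : Dˣ // α • i.rep ≤ j.rep ∧
        (α • i.rep).toAddSubgroup.relIndex j.rep.toAddSubgroup = n ^ 2} := by
  rw [matrix, Matrix.of_apply, weight, ← two_mul_unitIndex_mul_ncard_brandtSet hne n i.rep j.rep]
  push_cast
  ring

/-- The same count on *arbitrary* representatives `I' ∈ i`, `I ∈ j` (invertible right
`O`-ideals): `2 · w(O_L I') · T(n)_{[I'],[I]} = #{α ∈ Dˣ : α I' ⊆ I, [I : α I'] = n²}`
(`weight_mk`, `matrix_apply_eq_ncard`: both sides are class functions). [cite: Voight2021, (41.1.1) and 41.1.3] -/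
theorem two_mul_weight_mul_matrix_mk (hne : (1 : D) ≠ -1) (O : Submodule ℤ D) (n : ℕ)
    (I' I : rightIdeals O) :
    (2 * weight O (Quotient.mk (rightClassSetoid O) I') : ℤ) *
        matrix O n (Quotient.mk (rightClassSetoid O) I') (Quotient.mk (rightClassSetoid O) I) =
      Nat.card {α : Dˣ // α • (I' : Submodule ℤ D) ≤ (I : Submodule ℤ D) ∧
        (α • (I' : Submodule ℤ D)).toAddSubgroup.relIndex
          (I : Submodule ℤ D).toAddSubgroup = n ^ 2} := by
  rw [weight_mk, matrix_apply_eq_ncard, ← two_mul_unitIndex_mul_ncard_brandtSet hne n _ _]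
  push_cast
  ring

/-- **For a Brandt setup: `2 w_i · T(n)_ij = #{α ∈ Dˣ : α I_i ⊆ I_j, [I_j : α I_i] = n²}`**
unconditionally (`1 ≠ -1` in the quaternion algebra of a setup; both sides are finite honest
counts: `XiSetup.finite_units`, `finite_brandtSet`). [cite: Voight2021, (41.1.1) and 41.1.3] -/
theorem XiSetup.two_mul_weight_mul_matrix_apply {Nplus Nminus : ℕ} (S : XiSetup Nplus Nminus)
    (n : ℕ) (i j : ClassSet S.O) :
    (2 * weight S.O i : ℤ) * matrix S.O n i j =
      Nat.card {α : S.Dˣ // α • i.rep ≤ j.rep ∧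
        (α • i.rep).toAddSubgroup.relIndex j.rep.toAddSubgroup = n ^ 2} :=
  Brandt.two_mul_weight_mul_matrix_apply S.one_ne_neg_one S.O n i j

/-! ### The junk row `n = 0` -/

/-- A translate `α • I` of a full lattice is a full lattice. [folklore] -/
theorem isFullLattice_units_smul {I : Submodule ℤ D} (hI : IsFullLattice D I) (α : Dˣ) :
    IsFullLattice D (α • I) := by
  refine ⟨?_, fun d => ?_⟩
  · obtain ⟨t, ht⟩ := hI.1
    rw [Submodule.fg_def]
    refine ⟨α • (t : Set D), t.finite_toSet.smul_set, ?_⟩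
    rw [← Submodule.smul_span, ht]
    rfl
  · obtain ⟨n, hn, hnd⟩ := hI.2 ((α⁻¹ : Dˣ) • d)
    refine ⟨n, hn, ?_⟩
    rw [mem_units_smul_submodule_iff, smul_comm]
    exact hnd

/-- **The junk row `n = 0` of the Brandt matrices vanishes: `T(0) = 0`.** A translate `α I_i` of
the full lattice `I_i` inside `I_j` has finite (non-zero) index, so no `J` has "index `0² = 0`"
(`D` additively torsion-free, e.g. an algebra over `ℚ`). [folklore] -/
theorem matrix_zero [IsAddTorsionFree D] (O : Submodule ℤ D) : matrix O 0 = 0 := by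
  ext i j
  rw [matrix, Matrix.of_apply, Matrix.zero_apply]
  have h : {J : Submodule ℤ D | J ≤ j.rep ∧ J.toAddSubgroup.relIndex j.rep.toAddSubgroup = 0 ^ 2 ∧
      ∃ α : Dˣ, J = α • i.rep} = ∅ := by
    rw [Set.eq_empty_iff_forall_notMem]
    rintro J ⟨-, hidx, α, rfl⟩
    obtain ⟨m, hm, hmJ⟩ := exists_smul_mem_of_fg (isFullLattice_units_smul i.rep_mem.1 α)
      j.rep_mem.1.1
    exact relIndex_ne_zero_of_smul_mem j.rep j.rep_mem.1.1 hm (α • i.rep) hmJ (by simpa using hidx)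
  rw [h, Set.ncard_empty, Nat.cast_zero]

/-- `T(0) = 0` for every Brandt setup. [folklore] -/
theorem XiSetup.matrix_zero {Nplus Nminus : ℕ} (S : XiSetup Nplus Nminus) : matrix S.O 0 = 0 :=
  haveI : IsAddTorsionFree S.D := isAddTorsionFree_of_charZero_module ℚ S.D
  Brandt.matrix_zero S.O

end Brandt

end Literature.NumberTheory.Automorphic

end
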